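import Summits.CriticalPhenomena.PercolationContinuityZ3.Theorems.PercNearOneGluingNoHeavyLowerTailCSHUnfoldDecoy
import Summits.CriticalPhenomena.PercolationContinuityZ3.Theorems.PercNearOneGluingNoHeavyLowerTailCovTauBridge
import HarnessLib

/-!
# Crux `PercNearOneGluing.AdditiveGluing` (stmt-CriticalPhenomena-4576): the conditioned slack hierarchy — world bookkeeping for the
# general unfolding (zeroed-weight worlds = BHK sums off the cut; the margin commutes with world covariances; the pointwise CLAIM on margins)

Support file (`--supports stmt-CriticalPhenomena-4576`, lead-of-record prim-png-lead-4576 gen 12; part 1 of the GENERAL-`k` ASSEMBLY of Lemma U + Lemma H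
= hypothesis `hU` of `CSH.cshMargin_nonneg_of_unfold`, memo `prim-hp-8/PROOF-S5-ALL-R.md` §3.3–3.5).  No definitions, no named facts, no sorries.

Dictionary between the two world vocabularies of the cell: the induction skeleton / Lemma T (`CSH.cshMargin_nonneg_of_within`) integrate over
`prodBernoulli w^ω`, `w^ω` = `w` ZEROED on the pairs meeting the open vertex cluster of `Y` (= `HullPort.cut Y ω`, literally); prim-hp-8 / prim-ineq-prove-1's
Lemma-U tools (`CSH.wmeanOff`, `CSH.wcovOff`, `CSH.decoy_world_term`) sum `weight w η · φ(η ∖ cut Y ω)`.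
* `wmeanOff_eq_integral_zeroed`, `wcovOff_ind_eq_zeroed` — world means / covariances with an indicator are zeroed-weight (set) integrals;
* `wcovOff_const_right`, `wcovOff_finset_lin` — the world covariance kills constants and is linear in the test function;
* `cshMarg_wcovOff_comm` — the margin (a fixed finite linear combination, `CSH.cshMarg_eq_sum_single`) commutes with the world covariance;
* `cshMarg_ind_openConn_eq` — THE POINTWISE CLAIM of Lemma U on margins: in a configuration `ζ`,
  `Marg[u ↦ 1{x↔u}] = (J_{S'}(o) − p J_{S'}(v)) − (unfoldT(o) − p·unfoldT(v)) + (unfoldK(o) − p·unfoldK(v))`, `S' = {x} ∪ decoys`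
  (prim-ineq-prove-1's `CSH.slForm_jn` at `S = {x}`).
[cite: VandenbergHaggstromKahn2005, §2.1 Lemmas 2.3–2.4 (p. 10)] [cite: KozmaNitzan2024, Conj. 4 (p. 32)]
-/

noncomputable section

namespace Summit.CriticalPhenomena.PercolationContinuityZ3.Theorems.CSH

open MeasureTheory Set
open Literature.Probability.LatticeModels (prodBernoulli)
open Literature.Probability.Percolation
open Literature.Probability.Percolation.BHK2006 (weight integral_comp_sdiff_prodBernoulli)
open DecisionTree (ind ind_of_mem ind_of_not_mem ind_nonneg)
open HullPort (cut avoidEv)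
open CovTau (sum_weight_mul_eq_integral ind_eq_indicator_one sum_weight_coe_eq_one)
open scoped Classical

variable {V : Type*} [Fintype V]

/-- **World means are zeroed-weight integrals**: `Σ_η weight(η) φ(η ∖ cut_Y ω) = ∫ φ dμ_{w^ω}`, `w^ω` = `w` zeroed on `cut_Y ω`.
[cite: VandenbergHaggstromKahn2005, §2.1 Lemmas 2.3–2.4 (p. 10)] -/
theorem wmeanOff_eq_integral_zeroed (w : Sym2 V → unitInterval) (Y : Set V) (φ : Set (Sym2 V) → ℝ) (ω : Set (Sym2 V)) :
    wmeanOff (fun e => (w e : ℝ)) Y φ ω =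
      ∫ η, φ η ∂(prodBernoulli fun e => if (∃ z ∈ e, ∃ y ∈ Y, (openGraph ω).Reachable y z) then (0 : unitInterval) else w e) := by
  rw [wmeanOff, sum_weight_mul_eq_integral, integral_comp_sdiff_prodBernoulli w (cut Y ω) φ]
  congr 2
  funext e
  by_cases h : ∃ z ∈ e, ∃ y ∈ Y, (openGraph ω).Reachable y z
  · rw [if_pos h, if_pos (show e ∈ cut Y ω from h)]
  · rw [if_neg h, if_neg (show e ∉ cut Y ω from h)]

/-- **World covariance with an indicator is the zeroed-weight covariance bracket**:
`Cov_{world(ω)}(φ, 1_A) = ∫_A φ dμ_{w^ω} − (∫ φ dμ_{w^ω})·μ_{w^ω}(A)`. [cite: VandenbergHaggstromKahn2005, §2.1 Lemmas 2.3–2.4 (p. 10)] -/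
theorem wcovOff_ind_eq_zeroed (w : Sym2 V → unitInterval) (Y : Set V) (φ : Set (Sym2 V) → ℝ) (A : Set (BondConfig V))
    (ω : Set (Sym2 V)) :
    wcovOff (fun e => (w e : ℝ)) Y φ (fun ζ => ind A ζ) ω =
      (∫ η in A, φ η ∂(prodBernoulli fun e => if (∃ z ∈ e, ∃ y ∈ Y, (openGraph ω).Reachable y z) then (0 : unitInterval) else w e)) -
        (∫ η, φ η ∂(prodBernoulli fun e => if (∃ z ∈ e, ∃ y ∈ Y, (openGraph ω).Reachable y z) then (0 : unitInterval) else w e)) *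
          (prodBernoulli fun e => if (∃ z ∈ e, ∃ y ∈ Y, (openGraph ω).Reachable y z) then (0 : unitInterval) else w e).real A := by
  rw [wcovOff, wmeanOff_eq_integral_zeroed, wmeanOff_eq_integral_zeroed, wmeanOff_eq_integral_zeroed, ind_eq_indicator_one,
    integral_indicator_one MeasurableSet.of_discrete, ← integral_indicator MeasurableSet.of_discrete]
  congr 2
  funext η
  by_cases h : η ∈ A
  · rw [ind_of_mem h, mul_one, indicator_of_mem h]
  · rw [ind_of_not_mem h, mul_zero, indicator_of_notMem h]

/-- The world covariance kills constants in the second slot. [folklore] -/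
theorem wcovOff_const_right (w : Sym2 V → ℝ) (hm : ∑ ω, weight w ω = 1) (Y : Set V) (φ : Set (Sym2 V) → ℝ) (c : ℝ)
    (ω : Set (Sym2 V)) : wcovOff w Y φ (fun _ => c) ω = 0 := by
  rw [wcovOff, wmeanOff_const w hm Y c ω]
  have : wmeanOff w Y (fun β => φ β * c) ω = wmeanOff w Y φ ω * c := by
    rw [wmeanOff, wmeanOff, Finset.sum_mul]
    exact Finset.sum_congr rfl fun η _ => by ring
  rw [this]; ring

/-- The world covariance is linear in the second slot over finite combinations:
`Cov(φ, Σ_i a_i ψ_i) = Σ_i a_i Cov(φ, ψ_i)`. [folklore] -/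
theorem wcovOff_finset_lin {ι : Type*} (w : Sym2 V → ℝ) (Y : Set V) (φ : Set (Sym2 V) → ℝ) (s : Finset ι) (a : ι → ℝ)
    (ψ : ι → Set (Sym2 V) → ℝ) (ω : Set (Sym2 V)) :
    wcovOff w Y φ (fun ζ => ∑ i ∈ s, a i * ψ i ζ) ω = ∑ i ∈ s, a i * wcovOff w Y φ (ψ i) ω := by
  rw [wcovOff_eq_sum]
  have e : ∀ η, weight w η * ((φ (η \ cut Y ω) - wmeanOff w Y φ ω) * ∑ i ∈ s, a i * ψ i (η \ cut Y ω)) =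
      ∑ i ∈ s, a i * (weight w η * ((φ (η \ cut Y ω) - wmeanOff w Y φ ω) * ψ i (η \ cut Y ω))) := by
    intro η
    rw [Finset.mul_sum, Finset.mul_sum]
    exact Finset.sum_congr rfl fun i _ => by ring
  rw [Finset.sum_congr rfl (fun η _ => e η), Finset.sum_comm]
  refine Finset.sum_congr rfl fun i _ => ?_
  rw [wcovOff_eq_sum, Finset.mul_sum]

/-- **The margin commutes with the world covariance**: `Marg[u ↦ Cov_{world}(φ, ψ_u)] = Cov_{world}(φ, ζ ↦ Marg[u ↦ ψ_u(ζ)])`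
(both are the same finite linear combination, `CSH.cshMarg_eq_sum_single`). [folklore] -/
theorem cshMarg_wcovOff_comm (w : Sym2 V → ℝ) (Y : Set V) (φ : Set (Sym2 V) → ℝ) (L : List (V × (V → ℝ))) (p : ℝ) (o v : V)
    (ψ : V → Set (Sym2 V) → ℝ) (ω : Set (Sym2 V)) :
    cshMarg L p o v (fun u => wcovOff w Y φ (ψ u) ω) = wcovOff w Y φ (fun ζ => cshMarg L p o v (fun u => ψ u ζ)) ω := by
  rw [cshMarg_eq_sum_single]
  have e : (fun ζ => cshMarg L p o v (fun u => ψ u ζ)) = fun ζ => ∑ u, cshMarg L p o v (Pi.single u (1 : ℝ)) * ψ u ζ := by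
    funext ζ; rw [cshMarg_eq_sum_single]
  rw [e, wcovOff_finset_lin]

omit [Fintype V] in
/-- `1{x ↔ u}(ζ) = χ_x(u)` for the reachability relation of `ζ` (prim-ineq-prove-1's `CSH.chi`). [folklore] -/
theorem ind_openConn_eq_chi (x u : V) (ζ : Set (Sym2 V)) :
    ind (openConn x u : Set (BondConfig V)) ζ = chi (openGraph ζ).Reachable u x := by
  rw [chi_reachable_eq_ind]

omit [Fintype V] in
/-- **THE POINTWISE CLAIM OF LEMMA U ON MARGINS** (memo §3.3): in a configuration `ζ`, with `R` its open-reachability relation and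
`S' = {x} ∪ decoys(L)`:  `Marg_L[u ↦ 1{x↔u}(ζ)] = (J_{S'}(o) − p J_{S'}(v)) − (unfoldT_R {x} L o − p unfoldT_R {x} L v) + (unfoldK L o − p unfoldK L v)`.
(transcription of the cell memo prim-hp-8 PROOF-S5-ALL-R.md §3.3, via `CSH.slForm_jn`) [folklore] -/
theorem cshMarg_ind_openConn_eq (L : List (V × (V → ℝ))) (p : ℝ) (x o v : V) (ζ : Set (Sym2 V)) :
    cshMarg L p o v (fun u => ind (openConn x u : Set (BondConfig V)) ζ) =
      (jn (openGraph ζ).Reachable ({x} ∪ {d | d ∈ L.map Prod.fst}) o -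
          p * jn (openGraph ζ).Reachable ({x} ∪ {d | d ∈ L.map Prod.fst}) v) -
        (unfoldT (openGraph ζ).Reachable {x} L o - p * unfoldT (openGraph ζ).Reachable {x} L v) +
        (unfoldK L o - p * unfoldK L v) := by
  have hRs : ∀ a b, (openGraph ζ).Reachable a b → (openGraph ζ).Reachable b a := fun a b h => h.symm
  have hRt : ∀ a b c, (openGraph ζ).Reachable a b → (openGraph ζ).Reachable b c → (openGraph ζ).Reachable a c :=
    fun a b c h1 h2 => h1.trans h2
  have e : (fun u => ind (openConn x u : Set (BondConfig V)) ζ) = jn (openGraph ζ).Reachable {x} := by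
    funext u; rw [ind_openConn_eq_chi, jn_singleton]
  rw [e, cshMarg, slForm_jn _ hRs hRt, slForm_jn _ hRs hRt]
  ring

end Summit.CriticalPhenomena.PercolationContinuityZ3.Theorems.CSH

end
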